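import Summits.AnomalousDissipation.AnomalousDissipation.Theorems.SolenoidalFractalHomogenisationLagrangianStepCellLawVSectorExact
import HarnessLib

/-!
# K1L `LagrangianRenormalisationStep(Design)` (K1L_D, stmt-AnomalousDissipation-27980; aside 24912), stub `stub_cellLawV0_IS`
# — UNCONDITIONAL sectorial NON-EXPANSION of the quasi-static excess `excQS W M S` for EVERY word (p5's (L3) «κ ≤ 1 always», (L1⁺) discharged)
# (helper; `--supports stmt-AnomalousDissipation-27980`; word-independent)

Summits-side helper file of route `SolenoidalFractalHomogenisation` (prover seat `ad-k1l-cellLawV-w1` g2).  k3l g4's `oddSectorial_excQS_of_slot`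
(p644915) proves `NearIso S lo hi ∧ OddSectorial S τ ⇒ OddSectorial (excQS W M S) τ` from the per-slot hypothesis (L1⁺): the slot response
`f_{T_s}(B)` of every block `B` in the Kato sector `τ` with window `[lo, hi]` is (a) in the sector `τ` and (b) has non-negative quadratic form.
Both are now THEOREMS: (a) is `sector_form_qsResp_exact` (p659391, time-domain Green pairing); (b) is `form_qsResp_nonneg` below (the Green energy
identity at `x = z`: `(4/T)·xᵀf_T(B)x = ∫₀¹[(a+b)·C(a+b) + (b−a)·C(b−a)] + |a(1)|² + |b(0)|² ≥ 0`).  Hence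
**`oddSectorial_excQS_nonexpansion`**: for EVERY word `W`, `M ≥ 0`, `0 ≤ lo ≤ 1 ≤ hi`, `τ ≥ 0`:
`NearIso S lo hi ∧ OddSectorial S τ ⇒ OddSectorial (excQS W M S) τ` — and `oddSectorial_smul_excQS_nonexpansion` for `N⁻¹·excQS`.
Everything PROVED, no definition, no named fact, no sorry.  Infrastructure for route-1's rung leaf F-D1.A0 (frontier FORMAL rung); NOT a proof of the
stub, of the crux, of Onsager's conjecture or of anomalous dissipation.  Prover seat `ad-k1l-cellLawV-w1` g2, 2026-08-28.
-/

set_option linter.dupNamespace false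

noncomputable section

namespace Summit.AnomalousDissipation.AnomalousDissipation.Theorems.SolenoidalFractalHomogenisation.LagrangianStep.OddGain

open Matrix Finset MeasureTheory Set
open Literature.Analysis Literature.Analysis.FunctionSpaces Literature.Analysis.FluidPDE
open Literature.Analysis.FluidPDE.LatticeShear

/-! ## §19 Non-negativity of the slot response form and unconditional non-expansion -/

section NonExpansion

variable {k : ℕ}

/-- **The Green energy representation of the diagonal**: for `T > 0`, `C = T·B`, the forward/backward Duhamel solutions `a, b` with source `φ·x`:
`(4/T)·xᵀf_T(B)x = ∫₀¹[(a+b)·Cᵀ(a+b) + (b−a)·C(b−a)] + a(1)·a(1) + b(0)·b(0)`. [folklore] -/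
theorem four_div_mul_form_qsResp_eq {ρ T : ℝ} (hT : 0 < T) (B : Matrix (Fin 3) (Fin 3) ℝ) (x : Fin 3 → ℝ) :
    4 / T * (x ⬝ᵥ (qsResp ρ T B) *ᵥ x) =
      (∫ s in (0:ℝ)..1,
        ((((NormedSpace.exp (-(s • (T • B)))) *ᵥ fun k => ∫ r in (0:ℝ)..s,
            LatticeShear.LatticeWord.trapezoid 0 1 ρ r * ((NormedSpace.exp (r • (T • B))) *ᵥ x) k) +
          ((NormedSpace.exp (s • (T • B))) *ᵥ fun k => ∫ r in s..(1:ℝ),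
            LatticeShear.LatticeWord.trapezoid 0 1 ρ r * ((NormedSpace.exp (-(r • (T • B)))) *ᵥ x) k)) ⬝ᵥ
          ((T • B)ᵀ *ᵥ (((NormedSpace.exp (-(s • (T • B)))) *ᵥ fun k => ∫ r in (0:ℝ)..s,
            LatticeShear.LatticeWord.trapezoid 0 1 ρ r * ((NormedSpace.exp (r • (T • B))) *ᵥ x) k) +
          ((NormedSpace.exp (s • (T • B))) *ᵥ fun k => ∫ r in s..(1:ℝ),
            LatticeShear.LatticeWord.trapezoid 0 1 ρ r * ((NormedSpace.exp (-(r • (T • B)))) *ᵥ x) k))) +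
        (((NormedSpace.exp (s • (T • B))) *ᵥ fun k => ∫ r in s..(1:ℝ),
            LatticeShear.LatticeWord.trapezoid 0 1 ρ r * ((NormedSpace.exp (-(r • (T • B)))) *ᵥ x) k) -
          ((NormedSpace.exp (-(s • (T • B)))) *ᵥ fun k => ∫ r in (0:ℝ)..s,
            LatticeShear.LatticeWord.trapezoid 0 1 ρ r * ((NormedSpace.exp (r • (T • B))) *ᵥ x) k)) ⬝ᵥ
          ((T • B) *ᵥ (((NormedSpace.exp (s • (T • B))) *ᵥ fun k => ∫ r in s..(1:ℝ),
            LatticeShear.LatticeWord.trapezoid 0 1 ρ r * ((NormedSpace.exp (-(r • (T • B)))) *ᵥ x) k) -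
          ((NormedSpace.exp (-(s • (T • B)))) *ᵥ fun k => ∫ r in (0:ℝ)..s,
            LatticeShear.LatticeWord.trapezoid 0 1 ρ r * ((NormedSpace.exp (r • (T • B))) *ᵥ x) k))))) +
      (((NormedSpace.exp (-((1:ℝ) • (T • B)))) *ᵥ fun k => ∫ r in (0:ℝ)..1,
            LatticeShear.LatticeWord.trapezoid 0 1 ρ r * ((NormedSpace.exp (r • (T • B))) *ᵥ x) k) ⬝ᵥ
        ((NormedSpace.exp (-((1:ℝ) • (T • B)))) *ᵥ fun k => ∫ r in (0:ℝ)..1,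
            LatticeShear.LatticeWord.trapezoid 0 1 ρ r * ((NormedSpace.exp (r • (T • B))) *ᵥ x) k)) +
      (((NormedSpace.exp ((0:ℝ) • (T • B))) *ᵥ fun k => ∫ r in (0:ℝ)..(1:ℝ),
            LatticeShear.LatticeWord.trapezoid 0 1 ρ r * ((NormedSpace.exp (-(r • (T • B)))) *ᵥ x) k) ⬝ᵥ
        ((NormedSpace.exp ((0:ℝ) • (T • B))) *ᵥ fun k => ∫ r in (0:ℝ)..(1:ℝ),
            LatticeShear.LatticeWord.trapezoid 0 1 ρ r * ((NormedSpace.exp (-(r • (T • B)))) *ᵥ x) k)) := by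
  set C : Matrix (Fin 3) (Fin 3) ℝ := T • B with hC
  have hφ := continuous_trapezoid_unit ρ
  have hE := green_energy C hφ x x (hasDerivAt_duhamelFwd C hφ x) (duhamelFwd_zero C _ x) (hasDerivAt_duhamelBwd C hφ x)
    (duhamelBwd_one C _ x) (hasDerivAt_duhamelFwd C hφ x) (duhamelFwd_zero C _ x) (hasDerivAt_duhamelBwd C hφ x) (duhamelBwd_one C _ x)
  -- the pairing identity `2∫φ·x·(a+b) = (4/T)·xᵀf x`
  have hcf := continuous_iff_continuousAt.2 fun s => (hasDerivAt_duhamelFwd C hφ x s).continuousAt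
  have hcb := continuous_iff_continuousAt.2 fun s => (hasDerivAt_duhamelBwd C hφ x s).continuousAt
  have h1 := integral_pairing_duhamelFwd ρ T B x x
  have h2 := integral_pairing_duhamelBwd_eq ρ C x x
  rw [← hC] at h1
  have hi1 : IntervalIntegrable (fun s => LatticeShear.LatticeWord.trapezoid 0 1 ρ s *
      (x ⬝ᵥ ((NormedSpace.exp (-(s • C))) *ᵥ fun k => ∫ r in (0:ℝ)..s,
        LatticeShear.LatticeWord.trapezoid 0 1 ρ r * ((NormedSpace.exp (r • C)) *ᵥ x) k))) volume 0 1 :=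
    (hφ.mul (continuous_const.dotProduct hcf)).intervalIntegrable _ _
  have hi2 : IntervalIntegrable (fun s => LatticeShear.LatticeWord.trapezoid 0 1 ρ s *
      (x ⬝ᵥ ((NormedSpace.exp (s • C)) *ᵥ fun k => ∫ r in s..(1:ℝ),
        LatticeShear.LatticeWord.trapezoid 0 1 ρ r * ((NormedSpace.exp (-(r • C))) *ᵥ x) k))) volume 0 1 :=
    (hφ.mul (continuous_const.dotProduct hcb)).intervalIntegrable _ _
  have hF : 2 * ∫ s in (0:ℝ)..1, LatticeShear.LatticeWord.trapezoid 0 1 ρ s *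
      (x ⬝ᵥ (((NormedSpace.exp (-(s • C))) *ᵥ fun k => ∫ r in (0:ℝ)..s,
          LatticeShear.LatticeWord.trapezoid 0 1 ρ r * ((NormedSpace.exp (r • C)) *ᵥ x) k) +
        ((NormedSpace.exp (s • C)) *ᵥ fun k => ∫ r in s..(1:ℝ),
          LatticeShear.LatticeWord.trapezoid 0 1 ρ r * ((NormedSpace.exp (-(r • C))) *ᵥ x) k))) =
      4 / T * (x ⬝ᵥ (qsResp ρ T B) *ᵥ x) := by
    simp_rw [dotProduct_add, mul_add]
    rw [intervalIntegral.integral_add hi1 hi2, h2]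
    have hT0 : T ≠ 0 := hT.ne'
    field_simp
    linarith
  rw [hF] at hE
  linarith

/-- **The slot response of a block with non-negative quadratic form has non-negative quadratic form**: `0 ≤ xᵀf_T(B)x` (`T ≥ 0`), although
`xᵀe^{−tB}x` itself may change sign for non-symmetric `B`. [folklore] -/
theorem form_qsResp_nonneg {ρ T : ℝ} (hT : 0 ≤ T) {B : Matrix (Fin 3) (Fin 3) ℝ} (hpsd : ∀ u : Fin 3 → ℝ, 0 ≤ u ⬝ᵥ B *ᵥ u)
    (x : Fin 3 → ℝ) : 0 ≤ x ⬝ᵥ (qsResp ρ T B) *ᵥ x := by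
  rcases hT.eq_or_lt with h0 | hTpos
  · rw [form_qsResp_eq, ← h0, zero_mul]
  have hE := four_div_mul_form_qsResp_eq (ρ := ρ) hTpos B x
  have htr : ∀ u w : Fin 3 → ℝ, u ⬝ᵥ ((T • B)ᵀ *ᵥ w) = w ⬝ᵥ ((T • B) *ᵥ u) := fun u w => (form_comm_transpose (T • B) u w).symm
  have hpsdC : ∀ u : Fin 3 → ℝ, 0 ≤ u ⬝ᵥ (T • B) *ᵥ u := fun u => by
    rw [Matrix.smul_mulVec, dotProduct_smul, smul_eq_mul]; exact mul_nonneg hTpos.le (hpsd u)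
  have hnn : ∀ u : Fin 3 → ℝ, 0 ≤ u ⬝ᵥ u := fun u => by
    rw [self_dotProduct_eq_sum_sq]; exact Finset.sum_nonneg fun i _ => sq_nonneg _
  have hint : 0 ≤ ∫ s in (0:ℝ)..1,
        ((((NormedSpace.exp (-(s • (T • B)))) *ᵥ fun k => ∫ r in (0:ℝ)..s,
            LatticeShear.LatticeWord.trapezoid 0 1 ρ r * ((NormedSpace.exp (r • (T • B))) *ᵥ x) k) +
          ((NormedSpace.exp (s • (T • B))) *ᵥ fun k => ∫ r in s..(1:ℝ),
            LatticeShear.LatticeWord.trapezoid 0 1 ρ r * ((NormedSpace.exp (-(r • (T • B)))) *ᵥ x) k)) ⬝ᵥ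
          ((T • B)ᵀ *ᵥ (((NormedSpace.exp (-(s • (T • B)))) *ᵥ fun k => ∫ r in (0:ℝ)..s,
            LatticeShear.LatticeWord.trapezoid 0 1 ρ r * ((NormedSpace.exp (r • (T • B))) *ᵥ x) k) +
          ((NormedSpace.exp (s • (T • B))) *ᵥ fun k => ∫ r in s..(1:ℝ),
            LatticeShear.LatticeWord.trapezoid 0 1 ρ r * ((NormedSpace.exp (-(r • (T • B)))) *ᵥ x) k))) +
        (((NormedSpace.exp (s • (T • B))) *ᵥ fun k => ∫ r in s..(1:ℝ),
            LatticeShear.LatticeWord.trapezoid 0 1 ρ r * ((NormedSpace.exp (-(r • (T • B)))) *ᵥ x) k) -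
          ((NormedSpace.exp (-(s • (T • B)))) *ᵥ fun k => ∫ r in (0:ℝ)..s,
            LatticeShear.LatticeWord.trapezoid 0 1 ρ r * ((NormedSpace.exp (r • (T • B))) *ᵥ x) k)) ⬝ᵥ
          ((T • B) *ᵥ (((NormedSpace.exp (s • (T • B))) *ᵥ fun k => ∫ r in s..(1:ℝ),
            LatticeShear.LatticeWord.trapezoid 0 1 ρ r * ((NormedSpace.exp (-(r • (T • B)))) *ᵥ x) k) -
          ((NormedSpace.exp (-(s • (T • B)))) *ᵥ fun k => ∫ r in (0:ℝ)..s,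
            LatticeShear.LatticeWord.trapezoid 0 1 ρ r * ((NormedSpace.exp (r • (T • B))) *ᵥ x) k)))) :=
    intervalIntegral.integral_nonneg zero_le_one fun s _ => by rw [htr]; exact add_nonneg (hpsdC _) (hpsdC _)
  have h4 : 0 ≤ 4 / T * (x ⬝ᵥ (qsResp ρ T B) *ᵥ x) := by rw [hE]; exact add_nonneg (add_nonneg hint (hnn _)) (hnn _)
  have hT4 : 0 < 4 / T := by positivity
  exact (mul_nonneg_iff_of_pos_left hT4).1 h4

/-- **UNCONDITIONAL SECTORIAL NON-EXPANSION OF THE QUASI-STATIC EXCESS** (p5's (L3) «κ ≤ 1 always», for EVERY word): `M ≥ 0`,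
`0 ≤ lo ≤ 1 ≤ hi`, `τ ≥ 0`, `NearIso S lo hi`, `OddSectorial S τ` ⇒ `OddSectorial (excQS W M S) τ` — k3l g4's `oddSectorial_excQS_of_slot`
(p644915) with its per-slot hypothesis (L1⁺) DISCHARGED by `sector_form_qsResp_exact` and `form_qsResp_nonneg`. [folklore] -/
theorem oddSectorial_excQS_nonexpansion (W : LatticeShear.LatticeWord k) {M : ℝ} (hM : 0 ≤ M) {lo hi τ : ℝ} (hlo : 0 ≤ lo) (hlo1 : lo ≤ 1)
    (hhi1 : 1 ≤ hi) (hτ : 0 ≤ τ) {S : Torus.Visc4 (Fin 3)} (hS : Torus.NearIso S lo hi) (hodd : OddSectorial S τ) :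
    OddSectorial (excQS W M S) τ := by
  refine oddSectorial_excQS_of_slot W M hlo hlo1 hhi1 (fun s B hsecB hwinB => ?_) hS hodd
  have hpsd : ∀ u : Fin 3 → ℝ, 0 ≤ u ⬝ᵥ B *ᵥ u := fun u =>
    (mul_nonneg hlo (by rw [self_dotProduct_eq_sum_sq]; exact Finset.sum_nonneg fun i _ => sq_nonneg _)).trans (hwinB u).1
  exact ⟨fun x y => sector_form_qsResp_exact (slotT_nonneg hM W s) hτ hpsd hsecB x y,
    fun x => form_qsResp_nonneg (slotT_nonneg hM W s) hpsd x⟩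

/-- … and for the normalised excess `N⁻¹·excQS W M S`. [folklore] -/
theorem oddSectorial_smul_excQS_nonexpansion (W : LatticeShear.LatticeWord k) {M : ℝ} (hM : 0 ≤ M) (N : ℝ) {lo hi τ : ℝ} (hlo : 0 ≤ lo)
    (hlo1 : lo ≤ 1) (hhi1 : 1 ≤ hi) (hτ : 0 ≤ τ) {S : Torus.Visc4 (Fin 3)} (hS : Torus.NearIso S lo hi) (hodd : OddSectorial S τ) :
    OddSectorial ((1 / N) • excQS W M S) τ :=
  (oddSectorial_excQS_nonexpansion W hM hlo hlo1 hhi1 hτ hS hodd).smul (1 / N)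

end NonExpansion

end Summit.AnomalousDissipation.AnomalousDissipation.Theorems.SolenoidalFractalHomogenisation.LagrangianStep.OddGain

end
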